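import Mathlib
import Literature.Analysis.FluidPDE.SelfSimilarEulerProfile
import Summits.NavierStokesRegularity.NavierStokesRegularity.Theorems.EulerZoomLiouvillePowerGaugeEulerLiouvilleHoopDefs

/-!
# R48 plate t51-WF: the profile system in TRANSPORT VARIABLES (W-form) (nsreg-p2 ROUND-48 «EVERY LINE, EVERY BEND»,
`NsregP2.R48.WFormProfileEq`, text from `r48/Sketch48.lean` c9b3454dee49e2f5 l.48–52 with the two local abbreviations
`transportW γ V y = γ • y + V y`, `modPressure γ P y = P y − γ(1−γ)/2‖y‖²` UNFOLDED; seat ns-ezl-w2 g5,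
`--supports stmt-NavierStokesRegularity-19832 --as helper`)

For a `γ`-profile `(V, P)` with centre `0` (`IsSelfSimilarEulerProfile γ 0 V P`: `(1−γ)V + DV[γy + V] + ∇P = 0`, `div V = 0`),
the transport field `W = γy + V` and the modified pressure `Π = P − ½γ(1−γ)‖y‖²` satisfy, at every point,
`DW(y)[W y] + (1−2γ) W y + ∇Π(y) = 0` and `div W = 3γ` (CIV arXiv:2602.17570 §3: constant coefficients; pointwise algebra).

HONEST FRAMING: pointwise algebra (a statement of a ROUND-48 instrument); nothing about the crux E (19832 OPEN) or NS regularity.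
[cite: ConstantinIgnatovaVicol2026Putative, §3.1.1 eq. (3.3), §3.4.3; nsreg-p2 R48 §1.1]
-/

noncomputable section

open Set Function Real WithLp InnerProductSpace
open scoped InnerProductSpace RealInnerProductSpace

set_option linter.dupNamespace false

namespace Summit.NavierStokesRegularity.NavierStokesRegularity.Theorems.PowerGaugeEulerLiouville.HoopCore

open Literature.Analysis Literature.Analysis.FluidPDE

/-- The gradient of the modified pressure: `∇(P − k/2·‖y‖²)·… `; precisely `∇(y ↦ P y − γ(1−γ)/2‖y‖²)(y) = ∇P(y) − γ(1−γ) y`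
for differentiable `P`. [folklore] -/
theorem gradient_modPressure {P : EuclideanSpace ℝ (Fin 3) → ℝ} (hP : Differentiable ℝ P) (γ : ℝ)
    (y : EuclideanSpace ℝ (Fin 3)) :
    gradient (fun y => P y - γ * (1 - γ) / 2 * ‖y‖ ^ 2) y = gradient P y - (γ * (1 - γ)) • y := by
  have h1 : HasFDerivAt (fun y : EuclideanSpace ℝ (Fin 3) => γ * (1 - γ) / 2 * ‖y‖ ^ 2)
      ((γ * (1 - γ) / 2) • (2 • innerSL ℝ y)) y :=
    (hasStrictFDerivAt_norm_sq y).hasFDerivAt.const_mul _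
  have h2 := (hP y).hasFDerivAt.fun_sub h1
  have hPg : ∀ v, fderiv ℝ P y v = ⟪gradient P y, v⟫ := fun v => (hP y).hasGradientAt.fderiv_apply
  have key : HasGradientAt (fun y => P y - γ * (1 - γ) / 2 * ‖y‖ ^ 2) (gradient P y - (γ * (1 - γ)) • y) y := by
    rw [hasGradientAt_iff_hasFDerivAt]
    refine h2.congr_fderiv ?_
    ext v
    rw [two_smul] at *
    simp only [_root_.sub_apply, _root_.smul_apply, _root_.add_apply, innerSL_apply_apply, smul_eq_mul,
      InnerProductSpace.toDual_apply_apply, inner_sub_left, real_inner_smul_left, hPg]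
    ring
  exact key.gradient

/-- **THE W-FORM OF THE PROFILE SYSTEM** (`NsregP2.R48.WFormProfileEq γ` with `transportW`, `modPressure` unfolded):
for a centre-`0` `γ`-profile `(V, P)`, at every `y`,
`D(γ·id + V)(y)[γy + V y] + (1 − 2γ)•(γy + V y) + ∇(P − γ(1−γ)/2‖·‖²)(y) = 0` and `div (γ·id + V)(y) = 3γ`.
[cite: ConstantinIgnatovaVicol2026Putative, §3.1.1 eq. (3.3); nsreg-p2 R48 §1.1] -/
theorem wFormProfileEq (γ : ℝ) :
    ∀ (V : EuclideanSpace ℝ (Fin 3) → EuclideanSpace ℝ (Fin 3)) (P : EuclideanSpace ℝ (Fin 3) → ℝ),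
      IsSelfSimilarEulerProfile γ 0 V P →
      ∀ y, fderiv ℝ (fun y => γ • y + V y) y (γ • y + V y) + (1 - 2 * γ) • (γ • y + V y)
            + gradient (fun y => P y - γ * (1 - γ) / 2 * ‖y‖ ^ 2) y = 0
          ∧ VectorCalculus.divergence (fun y => γ • y + V y) y = 3 * γ := by
  intro V P hprof y
  have hVd : Differentiable ℝ V := hprof.differentiable_velocity
  have hPd : Differentiable ℝ P := hprof.differentiable_pressure
  have hW : HasFDerivAt (fun y : EuclideanSpace ℝ (Fin 3) => γ • y + V y)
      (γ • ContinuousLinearMap.id ℝ (EuclideanSpace ℝ (Fin 3)) + fderiv ℝ V y) y :=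
    ((hasFDerivAt_id y).const_smul γ).add (hVd y).hasFDerivAt
  refine ⟨?_, ?_⟩
  · have hpe := hprof.profile_eq y
    rw [sub_zero] at hpe
    rw [hW.fderiv, gradient_modPressure hPd γ y, _root_.add_apply, _root_.smul_apply,
      ContinuousLinearMap.id_apply]
    linear_combination (norm := module) hpe
  · have h0 : VectorCalculus.divergence V y = 0 := hprof.divFree y
    rw [divergence_eq_sum_inner_fderiv (EuclideanSpace.basisFun (Fin 3) ℝ)] at h0 ⊢
    rw [hW.fderiv]
    have hon : ∀ i, ⟪(EuclideanSpace.basisFun (Fin 3) ℝ) i, (EuclideanSpace.basisFun (Fin 3) ℝ) i⟫ = (1 : ℝ) := by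
      intro i
      have h := orthonormal_iff_ite.mp (EuclideanSpace.basisFun (Fin 3) ℝ).orthonormal i i
      rwa [if_pos rfl] at h
    simp only [_root_.add_apply, _root_.smul_apply, ContinuousLinearMap.id_apply,
      inner_add_right, inner_smul_right, hon, Finset.sum_add_distrib, h0, mul_one, add_zero, Finset.sum_const,
      Finset.card_univ, Fintype.card_fin, nsmul_eq_mul, Nat.cast_ofNat]

end Summit.NavierStokesRegularity.NavierStokesRegularity.Theorems.PowerGaugeEulerLiouville.HoopCore

end
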